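import Summits.MatrixMultiplication.MatrixMultiplication.Theorems.SubgroupIdentityDesigns.Negative.CornerSums
import Summits.MatrixMultiplication.MatrixMultiplication.Theorems.SubgroupIdentityDesigns.Negative.PairIndependence
import Summits.MatrixMultiplication.MatrixMultiplication.Theorems.LevelOneGL2Designs.Negative.LevelSpace

/-!
# Opposite corners kill level-1 identity designs (negative lemmas for the crux
# `SubgroupIdentityDesigns`, stmt-MatrixMultiplication-14079) — VALUE = THEOREM (all p), NOT
# summit progress; the crux stays open.

**The certificate.**  Fix `e, d ∈ 𝔽_p ∖ {0, 1}`.  The function `λ` on `GL_2(𝔽_p)` equal to `+1`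
on the corner cells `C(1,1) ∪ C(e,d)` and `-1` on `C(e,1) ∪ C(1,d)`, where
`C(ε,δ) = [[ε,*],[0,1]]·[[1,0],[*,δ]] = {[[ε + xy, xδ],[y, δ]]}`, is annihilated by EVERY
level-1 test function (`CornerSums.corner_bracket`), has `λ(1) = 1`, and is supported on
products `a·b` with `a ∈ {[[ε, x],[0, 1]] : ε ∈ {1,e}}` and `b ∈ {[[1, 0],[y, δ]] : δ ∈ {1,d}}`
(`exists_corner_annihilator`; `exists_corner_annihilator_rev` is the same for the products `b·a`).

**Consequence (pair dependence, `PairIndependence.eq_zero_of_annihilator_on_*`).**  If a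
subgroup-TPP triple `(H₁, H₂, H₃)` of `GL_2(𝔽_p)` has one member containing the `2p` matrices
`[[ε, x],[0, 1]]` (`ε ∈ {1, e}`) and a DIFFERENT member containing the `2p` matrices
`[[1, 0],[y, δ]]` (`δ ∈ {1, d}`), then it carries no level-1 identity test
(`no_design_up₁_lo₂`, `…up₁_lo₃`, `…up₂_lo₃`, `…lo₁_up₂`, `…lo₁_up₃`, `…lo₂_up₃` — all six
placements, every prime `p`).  In particular (`e = d = -1`, `p ≠ 2`) the FRAME SURVIVOR
`(U⁺⋊⟨diag(-1,1)⟩, U⁻⋊⟨diag(1,-1)⟩, S)` of `FrameSurvivor.lean` — subgroup-TPP, inside all three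
pair walls, volume above the exact level-1 floor — has NO level-1 identity design
(`no_levelOne_design_signed_frame`, stated in the crux's own vocabulary): the two-`p`-member case
of the `(m,k) = (2,1)` cell is decided by the design, not by group structure, exactly as the
walls/Sylow analysis predicted, and this is the explicit all-`p` certificate for its survivors.

Scope (honest): the certificate needs OPPOSITE one-sided decorations (`diag(e,1)` with the upper
root group, `diag(1,d)` with the lower one, or the reversed products).  Same-corner decorations
of coprime orders (e.g. `U⁺⋊⟨diag(-1,1)⟩`, `U⁻⋊⟨diag(ω,1)⟩`, `ω³ = 1`, `p = 7`) give level-1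
INDEPENDENT pairs (census, kit job j110283), so the two-`p`-member case is not closed by pairs
alone.
-/

set_option linter.dupNamespace false

noncomputable section

open scoped BigOperators Classical
open Summit.MatrixMultiplication.MatrixMultiplication.Theorems.LieRankDesigns.Negative
  (GLm Mat fourierFn)
open Summit.MatrixMultiplication.MatrixMultiplication.Theorems.LevelOneGL2Designs.Negative
  (levelSubmodule levelSubmodule_bi_inv mem_levelSubmodule_iff fourierFn_mem_levelSubmodule)

namespace Summit.MatrixMultiplication.MatrixMultiplication.Theorems.SubgroupIdentityDesigns.Negative

section OppositeCorners

open Literature.Barriers.MatrixMultiplication (SubgroupTPP)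

variable {p : ℕ} [hp : Fact p.Prime]

/-- The identity matrix lies in the corner cell `C(ε, δ)` only at `ε = δ = 1`, `x = y = 0`. -/
theorem one_eq_corner_iff (ε δ x y : ZMod p) :
    (1 : Mat p 2) = !![ε + x * y, x * δ; y, δ] ↔ ε = 1 ∧ δ = 1 ∧ x = 0 ∧ y = 0 := by
  constructor
  · intro h
    have h00 := congrFun (congrFun h 0) 0
    have h01 := congrFun (congrFun h 0) 1
    have h10 := congrFun (congrFun h 1) 0
    have h11 := congrFun (congrFun h 1) 1
    simp at h00 h01 h10 h11
    rcases h01 with hx | hδ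
    · refine ⟨?_, h11.symm, hx, h10.symm⟩
      rw [hx, zero_mul, add_zero] at h00
      exact h00.symm
    · exact absurd (h11.trans hδ) one_ne_zero
  · rintro ⟨rfl, rfl, rfl, rfl⟩
    ext i j
    fin_cases i <;> fin_cases j <;> simp

/-- The identity matrix lies in the reversed corner cell `C'(ε, δ)` only at `ε = δ = 1`,
`x = y = 0`. -/
theorem one_eq_corner_rev_iff (ε δ x y : ZMod p) :
    (1 : Mat p 2) = !![ε, x; y * ε, x * y + δ] ↔ ε = 1 ∧ δ = 1 ∧ x = 0 ∧ y = 0 := by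
  constructor
  · intro h
    have h00 := congrFun (congrFun h 0) 0
    have h01 := congrFun (congrFun h 0) 1
    have h10 := congrFun (congrFun h 1) 0
    have h11 := congrFun (congrFun h 1) 1
    simp at h00 h01 h10 h11
    rcases h10 with hy | hε
    · refine ⟨h00.symm, ?_, h01.symm, hy⟩
      rw [← h01, zero_mul, zero_add] at h11
      exact h11.symm
    · exact absurd (h00.trans hε) one_ne_zero
  · rintro ⟨rfl, rfl, rfl, rfl⟩
    ext i j
    fin_cases i <;> fin_cases j <;> simp

/-- Factorisation of a corner-cell element:
`[[ε + xy, xδ],[y, δ]] = [[ε, x],[0, 1]]·[[1, 0],[y, δ]]` in `GL_2(𝔽_p)` (`ε, δ ≠ 0`). -/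
theorem exists_factor_corner {g : GLm p 2} {ε δ x y : ZMod p} (hε : ε ≠ 0) (hδ : δ ≠ 0)
    (h : (g : Mat p 2) = !![ε + x * y, x * δ; y, δ]) :
    ∃ a b : GLm p 2, g = a * b ∧ (a : Mat p 2) 1 0 = 0 ∧ (a : Mat p 2) 1 1 = 1 ∧
      (a : Mat p 2) 0 0 = ε ∧ (b : Mat p 2) 0 1 = 0 ∧ (b : Mat p 2) 0 0 = 1 ∧
      (b : Mat p 2) 1 1 = δ := by
  refine ⟨Matrix.GeneralLinearGroup.mkOfDetNeZero !![ε, x; 0, 1]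
      (by rw [Matrix.det_fin_two_of]; simpa using hε),
    Matrix.GeneralLinearGroup.mkOfDetNeZero !![1, 0; y, δ]
      (by rw [Matrix.det_fin_two_of]; simpa using hδ), ?_, rfl, rfl, rfl, rfl, rfl, rfl⟩
  apply Units.ext
  rw [Units.val_mul, h]
  show !![ε + x * y, x * δ; y, δ] = !![ε, x; 0, 1] * !![1, 0; y, δ]
  rw [Matrix.mul_fin_two]
  ext i j
  fin_cases i <;> fin_cases j <;> simp [mul_comm]

/-- Factorisation of a reversed corner-cell element:
`[[ε, x],[yε, xy + δ]] = [[1, 0],[y, δ]]·[[ε, x],[0, 1]]` in `GL_2(𝔽_p)` (`ε, δ ≠ 0`). -/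
theorem exists_factor_corner_rev {g : GLm p 2} {ε δ x y : ZMod p} (hε : ε ≠ 0) (hδ : δ ≠ 0)
    (h : (g : Mat p 2) = !![ε, x; y * ε, x * y + δ]) :
    ∃ b a : GLm p 2, g = b * a ∧ (b : Mat p 2) 0 1 = 0 ∧ (b : Mat p 2) 0 0 = 1 ∧
      (b : Mat p 2) 1 1 = δ ∧ (a : Mat p 2) 1 0 = 0 ∧ (a : Mat p 2) 1 1 = 1 ∧
      (a : Mat p 2) 0 0 = ε := by
  refine ⟨Matrix.GeneralLinearGroup.mkOfDetNeZero !![1, 0; y, δ]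
      (by rw [Matrix.det_fin_two_of]; simpa using hδ),
    Matrix.GeneralLinearGroup.mkOfDetNeZero !![ε, x; 0, 1]
      (by rw [Matrix.det_fin_two_of]; simpa using hε), ?_, rfl, rfl, rfl, rfl, rfl, rfl⟩
  apply Units.ext
  rw [Units.val_mul, h]
  show !![ε, x; y * ε, x * y + δ] = !![1, 0; y, δ] * !![ε, x; 0, 1]
  rw [Matrix.mul_fin_two]
  ext i j
  fin_cases i <;> fin_cases j <;> simp [mul_comm]

/-- The double indicator sum `Σ_{x,y} [x = 0 ∧ y = 0] = 1`. -/
theorem sum_sum_ite_and_eq_one :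
    ∑ x : ZMod p, ∑ y : ZMod p, (if x = 0 ∧ y = 0 then (1 : ℂ) else 0) = 1 := by
  rw [Finset.sum_eq_single (0 : ZMod p) (fun x _ hx => Finset.sum_eq_zero fun y _ =>
      if_neg fun h => hx h.1) (fun h => absurd (Finset.mem_univ _) h)]
  rw [Finset.sum_eq_single (0 : ZMod p) (fun y _ hy => if_neg fun h => hy h.2)
      (fun h => absurd (Finset.mem_univ _) h)]
  simp

/-- **THE CORNER ANNIHILATOR.**  For `e, d ∈ 𝔽_p ∖ {0, 1}` there is a function `λ` on `GL_2(𝔽_p)`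
with `λ(1) ≠ 0`, orthogonal to the whole level-1 test space `F_1|_G`, and supported on the
products `a b` with `a = [[ε, x],[0, 1]]`, `ε ∈ {1, e}`, and `b = [[1, 0],[y, δ]]`,
`δ ∈ {1, d}`.  (It is `+1` on the cells `C(1,1), C(e,d)` and `-1` on `C(e,1), C(1,d)`.) -/
theorem exists_corner_annihilator {e d : ZMod p} (he0 : e ≠ 0) (he1 : e ≠ 1) (hd0 : d ≠ 0)
    (hd1 : d ≠ 1) :
    ∃ lam : GLm p 2 → ℂ, lam 1 ≠ 0 ∧
      (∀ g, lam g ≠ 0 → ∃ a b : GLm p 2, g = a * b ∧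
        (a : Mat p 2) 1 0 = 0 ∧ (a : Mat p 2) 1 1 = 1 ∧
        ((a : Mat p 2) 0 0 = 1 ∨ (a : Mat p 2) 0 0 = e) ∧
        (b : Mat p 2) 0 1 = 0 ∧ (b : Mat p 2) 0 0 = 1 ∧
        ((b : Mat p 2) 1 1 = 1 ∨ (b : Mat p 2) 1 1 = d)) ∧
      ∀ F ∈ levelSubmodule p 2 1, ∑ g, lam g * F g = 0 := by
  refine ⟨fun g =>
      (∑ x : ZMod p, ∑ y : ZMod p,
          if (g : Mat p 2) = !![1 + x * y, x * 1; y, 1] then (1 : ℂ) else 0)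
      - (∑ x : ZMod p, ∑ y : ZMod p,
          if (g : Mat p 2) = !![e + x * y, x * 1; y, 1] then (1 : ℂ) else 0)
      - (∑ x : ZMod p, ∑ y : ZMod p,
          if (g : Mat p 2) = !![1 + x * y, x * d; y, d] then (1 : ℂ) else 0)
      + (∑ x : ZMod p, ∑ y : ZMod p,
          if (g : Mat p 2) = !![e + x * y, x * d; y, d] then (1 : ℂ) else 0), ?_, ?_, ?_⟩
  · -- value at the identity
    simp only [Units.val_one, one_eq_corner_iff, true_and, he1, hd1, false_and, if_false,
      Finset.sum_const_zero, sub_zero, add_zero, sum_sum_ite_and_eq_one]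
    exact one_ne_zero
  · -- support
    intro g hg
    by_contra hne
    apply hg
    have h0 : ∀ ε δ : ZMod p, ε ≠ 0 → δ ≠ 0 → (ε = 1 ∨ ε = e) → (δ = 1 ∨ δ = d) →
        (∑ x : ZMod p, ∑ y : ZMod p,
          if (g : Mat p 2) = !![ε + x * y, x * δ; y, δ] then (1 : ℂ) else 0) = 0 := by
      intro ε δ hε hδ hεe hδd
      refine Finset.sum_eq_zero fun x _ => Finset.sum_eq_zero fun y _ => if_neg fun h => ?_
      obtain ⟨a, b, hab, ha10, ha11, ha00, hb01, hb00, hb11⟩ := exists_factor_corner hε hδ h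
      exact hne ⟨a, b, hab, ha10, ha11, ha00 ▸ hεe, hb01, hb00, hb11 ▸ hδd⟩
    simp only [h0 1 1 one_ne_zero one_ne_zero (Or.inl rfl) (Or.inl rfl),
      h0 e 1 he0 one_ne_zero (Or.inr rfl) (Or.inl rfl),
      h0 1 d one_ne_zero hd0 (Or.inl rfl) (Or.inr rfl),
      h0 e d he0 hd0 (Or.inr rfl) (Or.inr rfl), sub_zero, add_zero]
  · -- annihilation
    intro F hF
    obtain ⟨c, hc, hFc⟩ := mem_levelSubmodule_iff.mp hF
    have hF' : F = fourierFn c := funext hFc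
    subst hF'
    simp only [sub_mul, add_mul, Finset.sum_sub_distrib, Finset.sum_add_distrib]
    rw [corner_push 1 1 (by simp) c, corner_push e 1 (by simpa using he0) c,
      corner_push 1 d (by simpa using hd0) c, corner_push e d (mul_ne_zero he0 hd0) c,
      ← Finset.sum_sub_distrib, ← Finset.sum_sub_distrib, ← Finset.sum_add_distrib]
    refine Finset.sum_eq_zero fun M _ => ?_
    rw [← mul_sub, ← mul_sub, ← mul_add]
    by_cases hM : M.det = 0
    · rw [corner_bracket M hM e hd0, mul_zero]
    · rw [hc M (one_lt_rank_of_det_ne_zero M hM), zero_mul]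

/-- **The reversed corner annihilator** (supported on the products `b a`). -/
theorem exists_corner_annihilator_rev {e d : ZMod p} (he0 : e ≠ 0) (he1 : e ≠ 1) (hd0 : d ≠ 0)
    (hd1 : d ≠ 1) :
    ∃ lam : GLm p 2 → ℂ, lam 1 ≠ 0 ∧
      (∀ g, lam g ≠ 0 → ∃ b a : GLm p 2, g = b * a ∧
        (b : Mat p 2) 0 1 = 0 ∧ (b : Mat p 2) 0 0 = 1 ∧
        ((b : Mat p 2) 1 1 = 1 ∨ (b : Mat p 2) 1 1 = d) ∧
        (a : Mat p 2) 1 0 = 0 ∧ (a : Mat p 2) 1 1 = 1 ∧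
        ((a : Mat p 2) 0 0 = 1 ∨ (a : Mat p 2) 0 0 = e)) ∧
      ∀ F ∈ levelSubmodule p 2 1, ∑ g, lam g * F g = 0 := by
  refine ⟨fun g =>
      (∑ x : ZMod p, ∑ y : ZMod p,
          if (g : Mat p 2) = !![1, x; y * 1, x * y + 1] then (1 : ℂ) else 0)
      - (∑ x : ZMod p, ∑ y : ZMod p,
          if (g : Mat p 2) = !![e, x; y * e, x * y + 1] then (1 : ℂ) else 0)
      - (∑ x : ZMod p, ∑ y : ZMod p,
          if (g : Mat p 2) = !![1, x; y * 1, x * y + d] then (1 : ℂ) else 0)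
      + (∑ x : ZMod p, ∑ y : ZMod p,
          if (g : Mat p 2) = !![e, x; y * e, x * y + d] then (1 : ℂ) else 0), ?_, ?_, ?_⟩
  · simp only [Units.val_one, one_eq_corner_rev_iff, true_and, he1, hd1, false_and, if_false,
      Finset.sum_const_zero, sub_zero, add_zero, sum_sum_ite_and_eq_one]
    exact one_ne_zero
  · intro g hg
    by_contra hne
    apply hg
    have h0 : ∀ ε δ : ZMod p, ε ≠ 0 → δ ≠ 0 → (ε = 1 ∨ ε = e) → (δ = 1 ∨ δ = d) →
        (∑ x : ZMod p, ∑ y : ZMod p,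
          if (g : Mat p 2) = !![ε, x; y * ε, x * y + δ] then (1 : ℂ) else 0) = 0 := by
      intro ε δ hε hδ hεe hδd
      refine Finset.sum_eq_zero fun x _ => Finset.sum_eq_zero fun y _ => if_neg fun h => ?_
      obtain ⟨b, a, hba, hb01, hb00, hb11, ha10, ha11, ha00⟩ := exists_factor_corner_rev hε hδ h
      exact hne ⟨b, a, hba, hb01, hb00, hb11 ▸ hδd, ha10, ha11, ha00 ▸ hεe⟩
    simp only [h0 1 1 one_ne_zero one_ne_zero (Or.inl rfl) (Or.inl rfl),
      h0 e 1 he0 one_ne_zero (Or.inr rfl) (Or.inl rfl),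
      h0 1 d one_ne_zero hd0 (Or.inl rfl) (Or.inr rfl),
      h0 e d he0 hd0 (Or.inr rfl) (Or.inr rfl), sub_zero, add_zero]
  · intro F hF
    obtain ⟨c, hc, hFc⟩ := mem_levelSubmodule_iff.mp hF
    have hF' : F = fourierFn c := funext hFc
    subst hF'
    simp only [sub_mul, add_mul, Finset.sum_sub_distrib, Finset.sum_add_distrib]
    rw [corner_push_rev 1 1 (by simp) c, corner_push_rev e 1 (by simpa using he0) c,
      corner_push_rev 1 d (by simpa using hd0) c, corner_push_rev e d (mul_ne_zero he0 hd0) c,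
      ← Finset.sum_sub_distrib, ← Finset.sum_sub_distrib, ← Finset.sum_add_distrib]
    refine Finset.sum_eq_zero fun M _ => ?_
    rw [← mul_sub, ← mul_sub, ← mul_add]
    by_cases hM : M.det = 0
    · rw [corner_bracket_rev M hM he0 d, mul_zero]
    · rw [hc M (one_lt_rank_of_det_ne_zero M hM), zero_mul]

/-! ### No level-1 identity test: the six placements -/

/-- From an annihilator supported on one of the three pair product sets to the absence of a
level-1 identity test (the three pair-independence theorems of `PairIndependence.lean`). -/
theorem no_idTest_of_annihilator {H₁ H₂ H₃ : Subgroup (GLm p 2)} (htpp : SubgroupTPP H₁ H₂ H₃)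
    (lam : GLm p 2 → ℂ) (h1 : lam 1 ≠ 0)
    (hann : ∀ F ∈ levelSubmodule p 2 1, ∑ g, lam g * F g = 0)
    (hsupp : (∀ g, lam g ≠ 0 → ∃ a ∈ H₁, ∃ b ∈ H₂, g = a * b) ∨
      (∀ g, lam g ≠ 0 → ∃ a ∈ H₁, ∃ c ∈ H₃, g = a * c) ∨
      (∀ g, lam g ≠ 0 → ∃ b ∈ H₂, ∃ c ∈ H₃, g = b * c)) :
    ¬ ∃ f ∈ levelSubmodule p 2 1, f 1 = 1 ∧
      ∀ a ∈ H₁, ∀ b ∈ H₂, ∀ c ∈ H₃, a * b * c ≠ 1 → f (a * b * c) = 0 := by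
  rintro ⟨f, hf, hf1, hf0⟩
  rcases hsupp with h | h | h
  · exact h1 (congrFun (eq_zero_of_annihilator_on_left (levelSubmodule p 2 1)
      levelSubmodule_bi_inv htpp hf hf1 hf0 lam h hann) 1)
  · exact h1 (congrFun (eq_zero_of_annihilator_on_outer (levelSubmodule p 2 1)
      levelSubmodule_bi_inv htpp hf hf1 hf0 lam h hann) 1)
  · exact h1 (congrFun (eq_zero_of_annihilator_on_right (levelSubmodule p 2 1)
      levelSubmodule_bi_inv htpp hf hf1 hf0 lam h hann) 1)

/-- **Upper corner in `H₁`, lower corner in `H₂`.**  If `H₁ ∋ [[ε, x],[0, 1]]` for all `x`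
and `ε ∈ {1, e}`, and `H₂ ∋ [[1, 0],[y, δ]]` for all `y` and `δ ∈ {1, d}` (`e, d ∉ {0, 1}`), a
subgroup-TPP triple `(H₁, H₂, H₃)` has no level-1 identity test. -/
theorem no_design_up₁_lo₂ {H₁ H₂ H₃ : Subgroup (GLm p 2)} (htpp : SubgroupTPP H₁ H₂ H₃)
    {e d : ZMod p} (he0 : e ≠ 0) (he1 : e ≠ 1) (hd0 : d ≠ 0) (hd1 : d ≠ 1)
    (hup : ∀ a : GLm p 2, (a : Mat p 2) 1 0 = 0 → (a : Mat p 2) 1 1 = 1 →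
      ((a : Mat p 2) 0 0 = 1 ∨ (a : Mat p 2) 0 0 = e) → a ∈ H₁)
    (hlo : ∀ b : GLm p 2, (b : Mat p 2) 0 1 = 0 → (b : Mat p 2) 0 0 = 1 →
      ((b : Mat p 2) 1 1 = 1 ∨ (b : Mat p 2) 1 1 = d) → b ∈ H₂) :
    ¬ ∃ f ∈ levelSubmodule p 2 1, f 1 = 1 ∧
      ∀ a ∈ H₁, ∀ b ∈ H₂, ∀ c ∈ H₃, a * b * c ≠ 1 → f (a * b * c) = 0 := by
  obtain ⟨lam, h1, hsupp, hann⟩ := exists_corner_annihilator he0 he1 hd0 hd1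
  refine no_idTest_of_annihilator htpp lam h1 hann (Or.inl fun g hg => ?_)
  obtain ⟨a, b, hab, ha10, ha11, ha00, hb01, hb00, hb11⟩ := hsupp g hg
  exact ⟨a, hup a ha10 ha11 ha00, b, hlo b hb01 hb00 hb11, hab⟩

/-- **Upper corner in `H₁`, lower corner in `H₃`.** -/
theorem no_design_up₁_lo₃ {H₁ H₂ H₃ : Subgroup (GLm p 2)} (htpp : SubgroupTPP H₁ H₂ H₃)
    {e d : ZMod p} (he0 : e ≠ 0) (he1 : e ≠ 1) (hd0 : d ≠ 0) (hd1 : d ≠ 1)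
    (hup : ∀ a : GLm p 2, (a : Mat p 2) 1 0 = 0 → (a : Mat p 2) 1 1 = 1 →
      ((a : Mat p 2) 0 0 = 1 ∨ (a : Mat p 2) 0 0 = e) → a ∈ H₁)
    (hlo : ∀ b : GLm p 2, (b : Mat p 2) 0 1 = 0 → (b : Mat p 2) 0 0 = 1 →
      ((b : Mat p 2) 1 1 = 1 ∨ (b : Mat p 2) 1 1 = d) → b ∈ H₃) :
    ¬ ∃ f ∈ levelSubmodule p 2 1, f 1 = 1 ∧
      ∀ a ∈ H₁, ∀ b ∈ H₂, ∀ c ∈ H₃, a * b * c ≠ 1 → f (a * b * c) = 0 := by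
  obtain ⟨lam, h1, hsupp, hann⟩ := exists_corner_annihilator he0 he1 hd0 hd1
  refine no_idTest_of_annihilator htpp lam h1 hann (Or.inr (Or.inl fun g hg => ?_))
  obtain ⟨a, b, hab, ha10, ha11, ha00, hb01, hb00, hb11⟩ := hsupp g hg
  exact ⟨a, hup a ha10 ha11 ha00, b, hlo b hb01 hb00 hb11, hab⟩

/-- **Upper corner in `H₂`, lower corner in `H₃`.** -/
theorem no_design_up₂_lo₃ {H₁ H₂ H₃ : Subgroup (GLm p 2)} (htpp : SubgroupTPP H₁ H₂ H₃)
    {e d : ZMod p} (he0 : e ≠ 0) (he1 : e ≠ 1) (hd0 : d ≠ 0) (hd1 : d ≠ 1)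
    (hup : ∀ a : GLm p 2, (a : Mat p 2) 1 0 = 0 → (a : Mat p 2) 1 1 = 1 →
      ((a : Mat p 2) 0 0 = 1 ∨ (a : Mat p 2) 0 0 = e) → a ∈ H₂)
    (hlo : ∀ b : GLm p 2, (b : Mat p 2) 0 1 = 0 → (b : Mat p 2) 0 0 = 1 →
      ((b : Mat p 2) 1 1 = 1 ∨ (b : Mat p 2) 1 1 = d) → b ∈ H₃) :
    ¬ ∃ f ∈ levelSubmodule p 2 1, f 1 = 1 ∧
      ∀ a ∈ H₁, ∀ b ∈ H₂, ∀ c ∈ H₃, a * b * c ≠ 1 → f (a * b * c) = 0 := by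
  obtain ⟨lam, h1, hsupp, hann⟩ := exists_corner_annihilator he0 he1 hd0 hd1
  refine no_idTest_of_annihilator htpp lam h1 hann (Or.inr (Or.inr fun g hg => ?_))
  obtain ⟨a, b, hab, ha10, ha11, ha00, hb01, hb00, hb11⟩ := hsupp g hg
  exact ⟨a, hup a ha10 ha11 ha00, b, hlo b hb01 hb00 hb11, hab⟩

/-- **Lower corner in `H₁`, upper corner in `H₂`** (reversed products). -/
theorem no_design_lo₁_up₂ {H₁ H₂ H₃ : Subgroup (GLm p 2)} (htpp : SubgroupTPP H₁ H₂ H₃)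
    {e d : ZMod p} (he0 : e ≠ 0) (he1 : e ≠ 1) (hd0 : d ≠ 0) (hd1 : d ≠ 1)
    (hlo : ∀ b : GLm p 2, (b : Mat p 2) 0 1 = 0 → (b : Mat p 2) 0 0 = 1 →
      ((b : Mat p 2) 1 1 = 1 ∨ (b : Mat p 2) 1 1 = d) → b ∈ H₁)
    (hup : ∀ a : GLm p 2, (a : Mat p 2) 1 0 = 0 → (a : Mat p 2) 1 1 = 1 →
      ((a : Mat p 2) 0 0 = 1 ∨ (a : Mat p 2) 0 0 = e) → a ∈ H₂) :
    ¬ ∃ f ∈ levelSubmodule p 2 1, f 1 = 1 ∧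
      ∀ a ∈ H₁, ∀ b ∈ H₂, ∀ c ∈ H₃, a * b * c ≠ 1 → f (a * b * c) = 0 := by
  obtain ⟨lam, h1, hsupp, hann⟩ := exists_corner_annihilator_rev he0 he1 hd0 hd1
  refine no_idTest_of_annihilator htpp lam h1 hann (Or.inl fun g hg => ?_)
  obtain ⟨b, a, hba, hb01, hb00, hb11, ha10, ha11, ha00⟩ := hsupp g hg
  exact ⟨b, hlo b hb01 hb00 hb11, a, hup a ha10 ha11 ha00, hba⟩

/-- **Lower corner in `H₁`, upper corner in `H₃`** (reversed products). -/
theorem no_design_lo₁_up₃ {H₁ H₂ H₃ : Subgroup (GLm p 2)} (htpp : SubgroupTPP H₁ H₂ H₃)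
    {e d : ZMod p} (he0 : e ≠ 0) (he1 : e ≠ 1) (hd0 : d ≠ 0) (hd1 : d ≠ 1)
    (hlo : ∀ b : GLm p 2, (b : Mat p 2) 0 1 = 0 → (b : Mat p 2) 0 0 = 1 →
      ((b : Mat p 2) 1 1 = 1 ∨ (b : Mat p 2) 1 1 = d) → b ∈ H₁)
    (hup : ∀ a : GLm p 2, (a : Mat p 2) 1 0 = 0 → (a : Mat p 2) 1 1 = 1 →
      ((a : Mat p 2) 0 0 = 1 ∨ (a : Mat p 2) 0 0 = e) → a ∈ H₃) :
    ¬ ∃ f ∈ levelSubmodule p 2 1, f 1 = 1 ∧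
      ∀ a ∈ H₁, ∀ b ∈ H₂, ∀ c ∈ H₃, a * b * c ≠ 1 → f (a * b * c) = 0 := by
  obtain ⟨lam, h1, hsupp, hann⟩ := exists_corner_annihilator_rev he0 he1 hd0 hd1
  refine no_idTest_of_annihilator htpp lam h1 hann (Or.inr (Or.inl fun g hg => ?_))
  obtain ⟨b, a, hba, hb01, hb00, hb11, ha10, ha11, ha00⟩ := hsupp g hg
  exact ⟨b, hlo b hb01 hb00 hb11, a, hup a ha10 ha11 ha00, hba⟩

/-- **Lower corner in `H₂`, upper corner in `H₃`** (reversed products). -/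
theorem no_design_lo₂_up₃ {H₁ H₂ H₃ : Subgroup (GLm p 2)} (htpp : SubgroupTPP H₁ H₂ H₃)
    {e d : ZMod p} (he0 : e ≠ 0) (he1 : e ≠ 1) (hd0 : d ≠ 0) (hd1 : d ≠ 1)
    (hlo : ∀ b : GLm p 2, (b : Mat p 2) 0 1 = 0 → (b : Mat p 2) 0 0 = 1 →
      ((b : Mat p 2) 1 1 = 1 ∨ (b : Mat p 2) 1 1 = d) → b ∈ H₂)
    (hup : ∀ a : GLm p 2, (a : Mat p 2) 1 0 = 0 → (a : Mat p 2) 1 1 = 1 →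
      ((a : Mat p 2) 0 0 = 1 ∨ (a : Mat p 2) 0 0 = e) → a ∈ H₃) :
    ¬ ∃ f ∈ levelSubmodule p 2 1, f 1 = 1 ∧
      ∀ a ∈ H₁, ∀ b ∈ H₂, ∀ c ∈ H₃, a * b * c ≠ 1 → f (a * b * c) = 0 := by
  obtain ⟨lam, h1, hsupp, hann⟩ := exists_corner_annihilator_rev he0 he1 hd0 hd1
  refine no_idTest_of_annihilator htpp lam h1 hann (Or.inr (Or.inr fun g hg => ?_))
  obtain ⟨b, a, hba, hb01, hb00, hb11, ha10, ha11, ha00⟩ := hsupp g hg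
  exact ⟨b, hlo b hb01 hb00 hb11, a, hup a ha10 ha11 ha00, hba⟩

/-! ### The frame survivor has no level-1 identity design (crux vocabulary) -/

/-- **THE FRAME SURVIVOR IS NOT A WITNESS.**  Let `p ≠ 2` and let `K₁ ⊇ {[[±1, x],[0, 1]]}`,
`K₂ ⊇ {[[1, 0],[y, ±1]]}` (e.g. the signed root subgroups `U⁺⋊⟨diag(-1,1)⟩`, `U⁻⋊⟨diag(1,-1)⟩` of
`FrameSurvivorGroups.exists_signedUpper_subgroup` / `exists_signedLower_subgroup`).  Then for EVERY
subgroup `H₃` with `(K₁, K₂, H₃)` subgroup-TPP, the identity-design clause of the crux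
`SubgroupIdentityDesigns` fails at level `k = 1`: in particular the frame survivor
`(K₁, K₂, (Q×Q)⋊⟨w⟩)` of `FrameSurvivor.frame_survivor` (TPP, inside all pair walls, volume
above the exact level-1 floor) is killed by the design, by an explicit all-`p` certificate. -/
theorem no_levelOne_design_signed_frame (hp2 : p ≠ 2) {K₁ K₂ H₃ : Subgroup (GLm p 2)}
    (hK₁ : ∀ a : GLm p 2, (a : Mat p 2) 1 0 = 0 → (a : Mat p 2) 1 1 = 1 →
      ((a : Mat p 2) 0 0 = 1 ∨ (a : Mat p 2) 0 0 = -1) → a ∈ K₁)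
    (hK₂ : ∀ b : GLm p 2, (b : Mat p 2) 0 1 = 0 → (b : Mat p 2) 0 0 = 1 →
      ((b : Mat p 2) 1 1 = 1 ∨ (b : Mat p 2) 1 1 = -1) → b ∈ K₂)
    (htpp : SubgroupTPP K₁ K₂ H₃) :
    ¬ ∃ c : Mat p 2 → ℂ, (∀ M, 1 < M.rank → c M = 0) ∧
      (∑ M, c M * ZMod.stdAddChar (Matrix.trace (M * ((1 : GLm p 2) : Mat p 2)))) = 1 ∧
      ∀ a ∈ K₁, ∀ b ∈ K₂, ∀ g ∈ H₃, a * b * g ≠ 1 →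
        (∑ M, c M *
          ZMod.stdAddChar (Matrix.trace (M * ((a * b * g : GLm p 2) : Mat p 2)))) = 0 := by
  have hchar : ringChar (ZMod p) ≠ 2 := by rw [ZMod.ringChar_zmod_n]; exact hp2
  have hne1 : (-1 : ZMod p) ≠ 1 := Ring.neg_one_ne_one_of_char_ne_two hchar
  have hne0 : (-1 : ZMod p) ≠ 0 := neg_ne_zero.mpr one_ne_zero
  rintro ⟨c, hc, hc1, hc0⟩
  exact no_design_up₁_lo₂ htpp hne0 hne1 hne0 hne1 hK₁ hK₂
    ⟨fourierFn c, fourierFn_mem_levelSubmodule hc, hc1,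
      fun a ha b hb g hg hne => hc0 a ha b hb g hg hne⟩

end OppositeCorners

end Summit.MatrixMultiplication.MatrixMultiplication.Theorems.SubgroupIdentityDesigns.Negative

end
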